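import Summits.Ventures.GridStability.Bench.GFMSMIBDeg4AQoriaV4physData
import Summits.Ventures.GridStability.Lyapunov.PolyRecastBox
import Mathlib.Tactic.Linarith
import Mathlib.Tactic.Positivity
import HarnessLib

/-!
# G3.a+ «GFM-SMIB-QoriaV4» deg-4 — REGION-SIZE rider «GFM-SMIB-DEG4 BALL+» (sub-box cover K = 8, supersession `_S8`) (recast half): the ellipsoid
# `σ² + κ² + ω²/100 ≤ (9/8)²` on `{h = 0}` lies in the certified sublevel piece `{V₄ ≤ 21/4}`

Venture GRIDFUSION, cell `gridfusion`; seat gridfusion-lyap-2 (generator g4 `gen_ball.py … subbox 8`; filed by g5 as the SUPERSESSION «BALL+» of the rider «GFM-SMIB-DEG4 BALL» of record — `Bench/GFMSMIBDeg4AQoriaV4physBall.lean` p548797, gauge radius `989/1000`, ONE box — under NEW names: this file `Bench/GFMSMIBDeg4AQoriaV4physBallS8.lean`, every declaration suffixed `_S8`; the files of record are untouched and remain the token's L object), LOW rider (pattern of «#50′ BALL» p537844 / «#62′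
WSCC9-DEG4-BALL» p543377, here with the SUB-BOX COVER lever): a kernel INNER description of the certified set of the deg-4
toolchain-A certificate of rung G3.a+ «GFM-SMIB-QoriaV4» (`Bench/GFMSMIBDeg4AQoriaV4phys{Data,}.lean`, sos-5 p470051 / p470060, A
file `cert/A/GFM-SMIB-deg4-A-QoriaV4phys.json` sha256 `be1bb781f69ae869…`; -roa companion `Bench/GFMSMIBDeg4AQoriaV4physRoa.lean`,
lyap-1), so that the converter-against-infinite-bus ROA sentence names a concrete neighbourhood of the synchronous equilibrium.
Inputs: the degree-4 literal `…_V_poly` (32 monomials) and the recast constraint(s) `…_h` of the Data file; the generic box majorant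
`Lyapunov/PolyRecastBox.lean` (p536818, `PolyRecast.eval_le_absBox`). NOTHING of the certificate is restated; generator `gen_ball.py
gfmsmib4 <out> subbox 8` (HOME/lean/lyap-2/g4/; `s` found by exact search on the 1/1000 grid, V_poly parsed from the TREE file).

WHAT IS PROVED (kernel). With `s = 9/8`: on `{h = 0}` (`h_j = κ_j² + σ_j² − 2κ_j`) the ellipsoid `sigma² + kappa² + omega²/100 ≤ s²`
is COVERED by 8 boxes split on the thresholds `τ_k²` of `sigma²` (`τ_k = ⌈s√(k/8)⌉` on the 1/1000 grid): in box `k` (`τ_k² < Σσ² ≤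
τ_(k+1)²`) one has `|σ_i| ≤ τ_(k+1)`, `0 ≤ κ_j ≤ s²/2`, `|ω| ≤ Ω_k` with `Ω_k ≥ 10·s√(s² − τ_k²)` rational, and the coefficient
majorant of `V` on EACH box is below the level (one `decide` per box, exact values at the theorems; worst ≈ 5.236132 ≤ 21/4); hence
`V ≤ 21/4 = c` — THE ELLIPSOID LIES IN THE CERTIFIED PIECE (`…_V_le_level_of_ball`). `s` is the largest multiple of `1/1000` passing
the 8-box test (at `s + 1/1000` the worst box majorant is ≈ 5.252436 > c); the ONE-box test of the first staging passed only `s =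
989/1000` (56.7°). The ω²-coefficient `1/100` of the ellipsoid is NOT the certificate gauge's `1/4500` (`φ = σ² + κ² + ω²/4500`, ω
in rad/s): with the gauge shape the crude majorant is frequency-limited (`|ω| ≤ √4500·s` makes the quartic ω-terms dominate; best `s
= 34/125`, 15.6°); the aspect ratio of an INNER ellipsoid is a free choice and `1/100` makes the test angle-limited (same unclamped
box test, exact scan in the generator, ω²-coefficient → angle reach / |Ω| reach: 1 → 66.9°/1.17 rad·s⁻¹ (s = 1167/1000), 1/100 →
56.7°/9.89 rad·s⁻¹ (s = 989/1000), 1/4500 → 15.6°/18.2 rad·s⁻¹ (s = 34/125)). In the model's coordinates (`σ² + κ² = 2 − 2cos u ≤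
u²`): every state of the MODEL with `(δ − δ^s)² + Ω²/100 ≤ (9/8)²` (`Ω` = frequency deviation in rad/s: angle displaced by ≤ 1.125
rad = 64.5° at nominal frequency, or a frequency deviation ≤ 11.25 rad/s = 3.58 % of `ω_b′ = 35500/113` at the operating angle)
starts inside the certified region (model half: sibling `…RoaBallS8Model.lean`); the degree / rad·s⁻¹ / percent renderings of `s` are
VALIDATED-column readings of the exact literal, nothing more.

THREE COLUMNS. CERTIFIED (kernel): the inclusion «ellipsoid of gauge radius `9/8` ∩ {h = 0} ⊆ {V ≤ 21/4}» for the certificate's `V`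
— a crude (box-cover coefficient-majorant) but exact inner estimate; the true inscribed radius of this shape is larger (float
estimate in HOME/lean/lyap-2/g4/true_radius.py, VALIDATED only; the residual slack is mixed-sign cancellation inside a box,
reachable only by an SOS inclusion identity — toolchain lane); an inner set of a CERTIFICATE's sublevel piece, never «the ROA of the
system». MODELLED: as the parent row (M′ = reduced-order droop / VSM grid-forming converter against an infinite bus ≡ classical SMIB
in physical time, model-3 `InverterBridgesSMIB` p462458, model-1 `SMIB.gfmQoriaV4Phys`; MODEL-VALIDITY MV-6D+MV-P+MV-Ω(ω_b′ =
35500/113): inner loops, filter / line / dc-side dynamics, current limits, voltage dynamics ABSENT). VALIDATED: only the renderings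
of `s`. No sentence here says a converter or a grid is stable.
-/

namespace Summit.Ventures.GridStability.Bench.GFMSMIB

open Literature.Computation.Certificates Literature.Computation.Certificates.SOS
open Literature.Computation.Certificates.SOS.Poly
open Summit.Ventures.GridStability.Lyapunov

noncomputable section

/-- Box 0 of the cover (`(0)² < Σσ² ≤ (199/500)²`), in the certificate's variable order `(sigma, kappa, omega)`. [folklore] -/
def deg4_A_QoriaV4phys_boxB0_S8 : List ℚ := [199/500, 81/128, 45/4]

set_option maxRecDepth 100000 in
/-- `absBox boxB0 V_poly ≤ 21/4` (ONE `decide` over the 32 monomials; exact value `219466879363128434286603/65536000000000000000000` ≈ 3.3487988). [folklore] -/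
theorem deg4_A_QoriaV4phys_absBox_le0_S8 :
    PolyRecast.absBox (vars deg4_A_QoriaV4phys_boxB0_S8) deg4_A_QoriaV4phys_V_poly ≤ 21 / 4 := by
  decide +kernel

/-- Box 1 of the cover (`(199/500)² < Σσ² ≤ (563/1000)²`), in the certificate's variable order `(sigma, kappa, omega)`. [folklore] -/
def deg4_A_QoriaV4phys_boxB1_S8 : List ℚ := [563/1000, 81/128, 10523/1000]

set_option maxRecDepth 100000 in
/-- `absBox boxB1 V_poly ≤ 21/4` (ONE `decide` over the 32 monomials; exact value `249194757546377452948187/65536000000000000000000` ≈ 3.8024102). [folklore] -/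
theorem deg4_A_QoriaV4phys_absBox_le1_S8 :
    PolyRecast.absBox (vars deg4_A_QoriaV4phys_boxB1_S8) deg4_A_QoriaV4phys_V_poly ≤ 21 / 4 := by
  decide +kernel

/-- Box 2 of the cover (`(563/1000)² < Σσ² ≤ (689/1000)²`), in the certificate's variable order `(sigma, kappa, omega)`. [folklore] -/
def deg4_A_QoriaV4phys_boxB2_S8 : List ℚ := [689/1000, 81/128, 487/50]

set_option maxRecDepth 100000 in
/-- `absBox boxB2 V_poly ≤ 21/4` (ONE `decide` over the 32 monomials; exact value `273939232361548496777003/65536000000000000000000` ≈ 4.1799810). [folklore] -/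
theorem deg4_A_QoriaV4phys_absBox_le2_S8 :
    PolyRecast.absBox (vars deg4_A_QoriaV4phys_boxB2_S8) deg4_A_QoriaV4phys_V_poly ≤ 21 / 4 := by
  decide +kernel

/-- Box 3 of the cover (`(689/1000)² < Σσ² ≤ (199/250)²`), in the certificate's variable order `(sigma, kappa, omega)`. [folklore] -/
def deg4_A_QoriaV4phys_boxB3_S8 : List ℚ := [199/250, 81/128, 4447/500]

set_option maxRecDepth 100000 in
/-- `absBox boxB3 V_poly ≤ 21/4` (ONE `decide` over the 32 monomials; exact value `59157398165301903200143/13107200000000000000000` ≈ 4.5133513). [folklore] -/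
theorem deg4_A_QoriaV4phys_absBox_le3_S8 :
    PolyRecast.absBox (vars deg4_A_QoriaV4phys_boxB3_S8) deg4_A_QoriaV4phys_V_poly ≤ 21 / 4 := by
  decide +kernel

/-- Box 4 of the cover (`(199/250)² < Σσ² ≤ (89/100)²`), in the certificate's variable order `(sigma, kappa, omega)`. [folklore] -/
def deg4_A_QoriaV4phys_boxB4_S8 : List ℚ := [89/100, 81/128, 159/20]

set_option maxRecDepth 100000 in
/-- `absBox boxB4 V_poly ≤ 21/4` (ONE `decide` over the 32 monomials; exact value `502763071724934096123/104857600000000000000` ≈ 4.7947223). [folklore] -/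
theorem deg4_A_QoriaV4phys_absBox_le4_S8 :
    PolyRecast.absBox (vars deg4_A_QoriaV4phys_boxB4_S8) deg4_A_QoriaV4phys_V_poly ≤ 21 / 4 := by
  decide +kernel

/-- Box 5 of the cover (`(89/100)² < Σσ² ≤ (39/40)²`), in the certificate's variable order `(sigma, kappa, omega)`. [folklore] -/
def deg4_A_QoriaV4phys_boxB5_S8 : List ℚ := [39/40, 81/128, 3441/500]

set_option maxRecDepth 100000 in
/-- `absBox boxB5 V_poly ≤ 21/4` (ONE `decide` over the 32 monomials; exact value `329304285667232209719819/65536000000000000000000` ≈ 5.0247846). [folklore] -/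
theorem deg4_A_QoriaV4phys_absBox_le5_S8 :
    PolyRecast.absBox (vars deg4_A_QoriaV4phys_boxB5_S8) deg4_A_QoriaV4phys_V_poly ≤ 21 / 4 := by
  decide +kernel

/-- Box 6 of the cover (`(39/40)² < Σσ² ≤ (1053/1000)²`), in the certificate's variable order `(sigma, kappa, omega)`. [folklore] -/
def deg4_A_QoriaV4phys_boxB6_S8 : List ℚ := [1053/1000, 81/128, 5613/1000]

set_option maxRecDepth 100000 in
/-- `absBox boxB6 V_poly ≤ 21/4` (ONE `decide` over the 32 monomials; exact value `339856864644033198511227/65536000000000000000000` ≈ 5.1858042). [folklore] -/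
theorem deg4_A_QoriaV4phys_absBox_le6_S8 :
    PolyRecast.absBox (vars deg4_A_QoriaV4phys_boxB6_S8) deg4_A_QoriaV4phys_V_poly ≤ 21 / 4 := by
  decide +kernel

/-- Box 7 of the cover (`(1053/1000)² < Σσ² ≤ (9/8)²`), in the certificate's variable order `(sigma, kappa, omega)`. [folklore] -/
def deg4_A_QoriaV4phys_boxB7_S8 : List ℚ := [9/8, 81/128, 99/25]

set_option maxRecDepth 100000 in
/-- `absBox boxB7 V_poly ≤ 21/4` (ONE `decide` over the 32 monomials; exact value `549048279233118742299/104857600000000000000` ≈ 5.2361324). [folklore] -/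
theorem deg4_A_QoriaV4phys_absBox_le7_S8 :
    PolyRecast.absBox (vars deg4_A_QoriaV4phys_boxB7_S8) deg4_A_QoriaV4phys_V_poly ≤ 21 / 4 := by
  decide +kernel

/-- Generic box step: coordinate bounds `|x_i| ≤ b_i` and a decided majorant `absBox [b_0, …] V_poly ≤ c` give `V ≤ c`
(`PolyRecast.eval_le_absBox`). [folklore] -/
theorem deg4_A_QoriaV4phys_V_le_of_box_S8 (sigma kappa omega : ℝ) (b0 b1 b2 : ℚ)
    (hdec : PolyRecast.absBox (vars [b0, b1, b2]) deg4_A_QoriaV4phys_V_poly ≤ 21 / 4)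
    (hb0 : |sigma| ≤ ((b0 : ℚ) : ℝ)) (hb1 : |kappa| ≤ ((b1 : ℚ) : ℝ)) (hb2 : |omega| ≤ ((b2 : ℚ) : ℝ)) :
    deg4_A_QoriaV4phys_V sigma kappa omega ≤ 21 / 4 := by
  have hB : ∀ i, |vars [sigma, kappa, omega] i| ≤ ((vars [b0, b1, b2] i : ℚ) : ℝ) := by
    intro i
    match i with
    | 0 => simpa using hb0
    | 1 => simpa using hb1
    | 2 => simpa using hb2
    | n + 3 => simp [vars]
  have h := PolyRecast.eval_le_absBox hB deg4_A_QoriaV4phys_V_poly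
  have hc : ((PolyRecast.absBox (vars [b0, b1, b2]) deg4_A_QoriaV4phys_V_poly : ℚ) : ℝ) ≤ ((21 / 4 : ℚ) : ℝ) := Rat.cast_le.2 hdec
  have hc' : ((21 / 4 : ℚ) : ℝ) = 21 / 4 := by norm_num
  exact h.trans (hc.trans_eq hc')

/-- **«BALL» (recast coordinates, sub-box cover K = 8): the ellipsoid of gauge radius `9/8` lies in the certified piece.**
For every point of `{h = 0}` with `sigma² + kappa² + omega²/100 ≤ (9/8)²`: `V ≤ 21/4`. [folklore] -/
theorem deg4_A_QoriaV4phys_V_le_level_of_ball_S8 (sigma kappa omega : ℝ)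
    (hh : deg4_A_QoriaV4phys_h sigma kappa omega = 0)
    (hball : sigma ^ 2 + kappa ^ 2 + omega ^ 2 / 100 ≤ (9 / 8 : ℝ) ^ 2) :
    deg4_A_QoriaV4phys_V sigma kappa omega ≤ 21 / 4 := by
  simp only [deg4_A_QoriaV4phys_h, deg4_A_QoriaV4phys_h_poly, eval_cons, eval_nil, Monomial.eval_eq, Monomial.evalFrom_cons, Monomial.evalFrom_nil,
    vars_cons_zero, vars_cons_succ] at hh
  push_cast at hh
  norm_num at hh
  have hk1 : |kappa| ≤ ((81/128 : ℚ) : ℝ) := by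
    have h' : |kappa| ≤ (81 / 128 : ℝ) := abs_le.2 ⟨by nlinarith [hh, sq_nonneg sigma, sq_nonneg kappa, sq_nonneg omega], by nlinarith [hh, hball, sq_nonneg sigma, sq_nonneg kappa, sq_nonneg omega]⟩
    simpa using h'
  rcases le_or_gt (sigma ^ 2) ((199 / 500 : ℝ) ^ 2) with hs1 | hs1
  · have hq0 : |sigma| ≤ ((199/500 : ℚ) : ℝ) := by
      have h' : |sigma| ≤ (199 / 500 : ℝ) := abs_le.2 (abs_le_of_sq_le_sq' (by linarith [hs1]) (by norm_num))
      simpa using h'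
    have hq2 : |omega| ≤ ((45/4 : ℚ) : ℝ) := by
      have h' : |omega| ≤ (45 / 4 : ℝ) := abs_le.2 (abs_le_of_sq_le_sq' (by linarith [hball, sq_nonneg sigma, sq_nonneg kappa]) (by norm_num))
      simpa using h'
    exact deg4_A_QoriaV4phys_V_le_of_box_S8 sigma kappa omega _ _ _ (by simpa only [deg4_A_QoriaV4phys_boxB0_S8] using deg4_A_QoriaV4phys_absBox_le0_S8) hq0 hk1 hq2
  rcases le_or_gt (sigma ^ 2) ((563 / 1000 : ℝ) ^ 2) with hs2 | hs2
  · have hq0 : |sigma| ≤ ((563/1000 : ℚ) : ℝ) := by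
      have h' : |sigma| ≤ (563 / 1000 : ℝ) := abs_le.2 (abs_le_of_sq_le_sq' (by linarith [hs2]) (by norm_num))
      simpa using h'
    have hq2 : |omega| ≤ ((10523/1000 : ℚ) : ℝ) := by
      have h' : |omega| ≤ (10523 / 1000 : ℝ) := abs_le.2 (abs_le_of_sq_le_sq' (by linarith [hs1, hball, sq_nonneg sigma, sq_nonneg kappa]) (by norm_num))
      simpa using h'
    exact deg4_A_QoriaV4phys_V_le_of_box_S8 sigma kappa omega _ _ _ (by simpa only [deg4_A_QoriaV4phys_boxB1_S8] using deg4_A_QoriaV4phys_absBox_le1_S8) hq0 hk1 hq2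
  rcases le_or_gt (sigma ^ 2) ((689 / 1000 : ℝ) ^ 2) with hs3 | hs3
  · have hq0 : |sigma| ≤ ((689/1000 : ℚ) : ℝ) := by
      have h' : |sigma| ≤ (689 / 1000 : ℝ) := abs_le.2 (abs_le_of_sq_le_sq' (by linarith [hs3]) (by norm_num))
      simpa using h'
    have hq2 : |omega| ≤ ((487/50 : ℚ) : ℝ) := by
      have h' : |omega| ≤ (487 / 50 : ℝ) := abs_le.2 (abs_le_of_sq_le_sq' (by linarith [hs2, hball, sq_nonneg sigma, sq_nonneg kappa]) (by norm_num))
      simpa using h'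
    exact deg4_A_QoriaV4phys_V_le_of_box_S8 sigma kappa omega _ _ _ (by simpa only [deg4_A_QoriaV4phys_boxB2_S8] using deg4_A_QoriaV4phys_absBox_le2_S8) hq0 hk1 hq2
  rcases le_or_gt (sigma ^ 2) ((199 / 250 : ℝ) ^ 2) with hs4 | hs4
  · have hq0 : |sigma| ≤ ((199/250 : ℚ) : ℝ) := by
      have h' : |sigma| ≤ (199 / 250 : ℝ) := abs_le.2 (abs_le_of_sq_le_sq' (by linarith [hs4]) (by norm_num))
      simpa using h'
    have hq2 : |omega| ≤ ((4447/500 : ℚ) : ℝ) := by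
      have h' : |omega| ≤ (4447 / 500 : ℝ) := abs_le.2 (abs_le_of_sq_le_sq' (by linarith [hs3, hball, sq_nonneg sigma, sq_nonneg kappa]) (by norm_num))
      simpa using h'
    exact deg4_A_QoriaV4phys_V_le_of_box_S8 sigma kappa omega _ _ _ (by simpa only [deg4_A_QoriaV4phys_boxB3_S8] using deg4_A_QoriaV4phys_absBox_le3_S8) hq0 hk1 hq2
  rcases le_or_gt (sigma ^ 2) ((89 / 100 : ℝ) ^ 2) with hs5 | hs5
  · have hq0 : |sigma| ≤ ((89/100 : ℚ) : ℝ) := by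
      have h' : |sigma| ≤ (89 / 100 : ℝ) := abs_le.2 (abs_le_of_sq_le_sq' (by linarith [hs5]) (by norm_num))
      simpa using h'
    have hq2 : |omega| ≤ ((159/20 : ℚ) : ℝ) := by
      have h' : |omega| ≤ (159 / 20 : ℝ) := abs_le.2 (abs_le_of_sq_le_sq' (by linarith [hs4, hball, sq_nonneg sigma, sq_nonneg kappa]) (by norm_num))
      simpa using h'
    exact deg4_A_QoriaV4phys_V_le_of_box_S8 sigma kappa omega _ _ _ (by simpa only [deg4_A_QoriaV4phys_boxB4_S8] using deg4_A_QoriaV4phys_absBox_le4_S8) hq0 hk1 hq2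
  rcases le_or_gt (sigma ^ 2) ((39 / 40 : ℝ) ^ 2) with hs6 | hs6
  · have hq0 : |sigma| ≤ ((39/40 : ℚ) : ℝ) := by
      have h' : |sigma| ≤ (39 / 40 : ℝ) := abs_le.2 (abs_le_of_sq_le_sq' (by linarith [hs6]) (by norm_num))
      simpa using h'
    have hq2 : |omega| ≤ ((3441/500 : ℚ) : ℝ) := by
      have h' : |omega| ≤ (3441 / 500 : ℝ) := abs_le.2 (abs_le_of_sq_le_sq' (by linarith [hs5, hball, sq_nonneg sigma, sq_nonneg kappa]) (by norm_num))
      simpa using h'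
    exact deg4_A_QoriaV4phys_V_le_of_box_S8 sigma kappa omega _ _ _ (by simpa only [deg4_A_QoriaV4phys_boxB5_S8] using deg4_A_QoriaV4phys_absBox_le5_S8) hq0 hk1 hq2
  rcases le_or_gt (sigma ^ 2) ((1053 / 1000 : ℝ) ^ 2) with hs7 | hs7
  · have hq0 : |sigma| ≤ ((1053/1000 : ℚ) : ℝ) := by
      have h' : |sigma| ≤ (1053 / 1000 : ℝ) := abs_le.2 (abs_le_of_sq_le_sq' (by linarith [hs7]) (by norm_num))
      simpa using h'
    have hq2 : |omega| ≤ ((5613/1000 : ℚ) : ℝ) := by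
      have h' : |omega| ≤ (5613 / 1000 : ℝ) := abs_le.2 (abs_le_of_sq_le_sq' (by linarith [hs6, hball, sq_nonneg sigma, sq_nonneg kappa]) (by norm_num))
      simpa using h'
    exact deg4_A_QoriaV4phys_V_le_of_box_S8 sigma kappa omega _ _ _ (by simpa only [deg4_A_QoriaV4phys_boxB6_S8] using deg4_A_QoriaV4phys_absBox_le6_S8) hq0 hk1 hq2
  have hq0 : |sigma| ≤ ((9/8 : ℚ) : ℝ) := by
    have h' : |sigma| ≤ (9 / 8 : ℝ) := abs_le.2 (abs_le_of_sq_le_sq' (by linarith [hball, sq_nonneg kappa, sq_nonneg omega]) (by norm_num))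
    simpa using h'
  have hq2 : |omega| ≤ ((99/25 : ℚ) : ℝ) := by
    have h' : |omega| ≤ (99 / 25 : ℝ) := abs_le.2 (abs_le_of_sq_le_sq' (by linarith [hs7, hball, sq_nonneg sigma, sq_nonneg kappa]) (by norm_num))
    simpa using h'
  exact deg4_A_QoriaV4phys_V_le_of_box_S8 sigma kappa omega _ _ _ (by simpa only [deg4_A_QoriaV4phys_boxB7_S8] using deg4_A_QoriaV4phys_absBox_le7_S8) hq0 hk1 hq2

end

end Summit.Ventures.GridStability.Bench.GFMSMIB
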